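import Summits.CriticalPhenomena.PercolationContinuityZ3.Theorems.PercNearOneGluingNoHeavyLowerTailSunflowerMultiPetalIsolated
import HarnessLib
import HarnessLib.Audit

/-!
# `NoHeavyLowerTail` (crux stmt-CriticalPhenomena-4575), abstract sunflower cubic, `k` petals: RESTRICTION MONOTONICITY (MZₖ) at a coordinate whose
# UPPER section uses at most one petal colour — the multi-petal generalisation of prim-ineq-gen-2's second one-point certificate, POINTWISE

Support file (seat `prim-l12-p2` gen 26; `--supports stmt-CriticalPhenomena-4575`; companion of `…SunflowerMultiPetal` (p338110), `…SunflowerMultiPetalSpectator`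
(p339016), `…SunflowerMultiPetalIsolated` (p339929), `…SunflowerRestrictionSeriesPair` (`nested`, `nested_insert_split`) and, for `k = 3`, prim-ineq-gen-2's
`…SunflowerOnePointCertificates` (`Sunflower.ZP_le_ZP_insert_of_upper_le_one_petal`)).  No `sorry`; nothing is asserted about the crux.
Memo: run/shared/lean/prim/prim-l12/prim-l12-p2/FINDING-g26-MULTIPETAL-COMPONENT-LEMMA.md §4.9.

THEOREM (`MSunflower.nested_le_nested_insert_of_upper_le_one_petal`, this work).  Let `F : MSunflower k α`, `W` a sub-cube and `e ∉ W` such that every upper label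
`lab (insert e X)`, `X ⊆ W`, lies in `{0, petalLab i₀, ⊤}` for ONE petal `i₀`.  Then
`nested W (s6K ∘ lab) ≤ nested (insert e W) (s6K ∘ lab)` — the sub-cube functional does not decrease when the free coordinate `e` is added ((MZₖ) at `e`).
PROOF: for every ordered 3-partition `(X,Y,Z)` of `W`, with lower labels `x₀,y₀,z₀` and upper labels `x₁,y₁,z₁` (`x₀ ≤ x₁` in `M_k`, `x₁ ∈ {0, p, ⊤}`):
  `s6K x₀ y₀ z₀ + [x₁ decided]·kkK y₀ z₀ + [y₁ decided]·kkK x₀ z₀ + [z₁ decided]·kkK x₀ y₀ ≤ s6K x₁ y₀ z₀ + s6K x₀ y₁ z₀ + s6K x₀ y₀ z₁`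
POINTWISE (`uopIneqK`; `decide` on `Fin 6` codes — three lower petals and the upper petal — transported to every `k` by a four-anchor chart `chart4`), and the decided-
spectator `kkK` sums are antipodal-Gladkov sums `≥ 0`.  No symmetrisation over block orders is needed.
-/

namespace Summit.CriticalPhenomena.PercolationContinuityZ3.Theorems.SunflowerPartition

open Finset

variable {α : Type*} [DecidableEq α]

/-! ## A four-anchor chart into `Fin 6` -/

/-- Chart with three anchors: top `↦ 5`, bottom `↦ 0`, `a ↦ 1`, `b ↦ 2`, `c ↦ 3`, anything else `↦ 4`. [this work] -/
def chart4 (k : ℕ) (a b c w : Fin (k + 2)) : Fin 6 :=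
  if w = Fin.last (k + 1) then 5 else if w = 0 then 0 else if w = a then 1 else if w = b then 2 else if w = c then 3 else 4

/-- `chart4` detects the top label. [this work] -/
theorem chart4_eq_five_iff (k : ℕ) (a b c w : Fin (k + 2)) : chart4 k a b c w = 5 ↔ w = Fin.last (k + 1) := by
  unfold chart4; split_ifs <;> simp_all

/-- `chart4` detects the bottom label. [this work] -/
theorem chart4_eq_zero_iff (k : ℕ) (a b c w : Fin (k + 2)) : chart4 k a b c w = 0 ↔ w = 0 := by
  unfold chart4
  split_ifs with h1 h2
  · simp only [show (5 : Fin 6) ≠ 0 by decide, false_iff]; rintro rfl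
    have := congrArg Fin.val h1; simp at this
  · simp [h2]
  all_goals simp_all

/-- `chart4` preserves equality of two labels when at most one "other" petal occurs among them. [this work] -/
theorem chart4_eq_iff (k : ℕ) (a b c : Fin (k + 2)) {w w' : Fin (k + 2)}
    (hz : w ≠ Fin.last (k + 1) → w ≠ 0 → w ≠ a → w ≠ b → w ≠ c → w' ≠ Fin.last (k + 1) → w' ≠ 0 → w' ≠ a → w' ≠ b → w' ≠ c → w = w') :
    w = w' ↔ chart4 k a b c w = chart4 k a b c w' := by
  constructor
  · rintro rfl; rfl
  · intro h
    unfold chart4 at h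
    split_ifs at h <;> first | (subst_vars; rfl) | simp_all

/-- Admissible one-point code on `Fin 6` (Boolean): `x0 ≤ x1` in `M_4` and the upper label is bottom, the petal `1` or top. [this work] -/
def uopCode (x0 x1 : Fin 6) : Bool := (x0 == x1 || x0 == 0 || x1 == 5) && (x1 == 0 || x1 == 1 || x1 == 5)

/-- The one-point kernel inequality on `Fin 6` codes (`decide`). [this work] -/
theorem uopIneq6 : ∀ x0 x1 y0 y1 z0 z1 : Fin 6, uopCode x0 x1 = true → uopCode y0 y1 = true → uopCode z0 z1 = true →
    s6K 4 x0 y0 z0 + decK 4 x1 * kkK 4 y0 z0 + decK 4 y1 * kkK 4 x0 z0 + decK 4 z1 * kkK 4 x0 y0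
      ≤ s6K 4 x1 y0 z0 + s6K 4 x0 y1 z0 + s6K 4 x0 y0 z1 := by
  decide

/-- From the two propositional conditions to the Boolean code. [this work] -/
theorem uopCode_of : ∀ a b : Fin 6, (a = b ∨ a = 0 ∨ b = 5) → (b = 0 ∨ b = 1 ∨ b = 5) → uopCode a b = true := by decide

/-- **The one-point kernel inequality for every `k`** (chart `p ↦ 1`, two lower labels as further anchors; at most one "other" petal). [this work] -/
theorem uopIneqK {k : ℕ} (p x0 x1 y0 y1 z0 z1 : Fin (k + 2))
    (hx : x0 = x1 ∨ x0 = 0 ∨ x1 = Fin.last (k + 1)) (hy : y0 = y1 ∨ y0 = 0 ∨ y1 = Fin.last (k + 1))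
    (hz : z0 = z1 ∨ z0 = 0 ∨ z1 = Fin.last (k + 1))
    (hx1 : x1 = 0 ∨ x1 = p ∨ x1 = Fin.last (k + 1)) (hy1 : y1 = 0 ∨ y1 = p ∨ y1 = Fin.last (k + 1))
    (hz1 : z1 = 0 ∨ z1 = p ∨ z1 = Fin.last (k + 1)) :
    s6K k x0 y0 z0 + decK k x1 * kkK k y0 z0 + decK k y1 * kkK k x0 z0 + decK k z1 * kkK k x0 y0
      ≤ s6K k x1 y0 z0 + s6K k x0 y1 z0 + s6K k x0 y0 z1 := by
  set c := chart4 k p x0 y0 with hc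
  have e5 : (5 : Fin 6) = Fin.last (4 + 1) := rfl
  have T := fun w => e5 ▸ (chart4_eq_five_iff k p x0 y0 w).symm
  have Zr := fun w => (chart4_eq_zero_iff k p x0 y0 w).symm
  -- labels that are never "other" petals
  have nX0 : x0 ≠ Fin.last (k + 1) → x0 ≠ 0 → x0 ≠ p → x0 ≠ x0 → x0 ≠ y0 → False := fun _ _ _ h _ => h rfl
  have nY0 : y0 ≠ Fin.last (k + 1) → y0 ≠ 0 → y0 ≠ p → y0 ≠ x0 → y0 ≠ y0 → False := fun _ _ _ _ h => h rfl
  have nU : ∀ {u : Fin (k + 2)}, (u = 0 ∨ u = p ∨ u = Fin.last (k + 1)) →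
      (u ≠ Fin.last (k + 1) → u ≠ 0 → u ≠ p → u ≠ x0 → u ≠ y0 → False) := by
    intro u hu ht h0 hp _ _
    rcases hu with h | h | h
    · exact h0 h
    · exact hp h
    · exact ht h
  have E1 : ∀ {w w' : Fin (k + 2)}, (w ≠ Fin.last (k + 1) → w ≠ 0 → w ≠ p → w ≠ x0 → w ≠ y0 → False) → (w = w' ↔ c w = c w') :=
    fun hw => chart4_eq_iff k p x0 y0 (fun a b d g i _ _ _ _ _ => (hw a b d g i).elim)
  have E2 : ∀ {w w' : Fin (k + 2)}, (w' ≠ Fin.last (k + 1) → w' ≠ 0 → w' ≠ p → w' ≠ x0 → w' ≠ y0 → False) → (w = w' ↔ c w = c w') :=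
    fun hw => chart4_eq_iff k p x0 y0 (fun _ _ _ _ _ a b d g i => (hw a b d g i).elim)
  rw [s6K_congr (T x0) (Zr x0) (T y0) (Zr y0) (T z0) (Zr z0) (E1 nX0) (E1 nY0) (E1 nX0),
    decK_congr (T x1) (Zr x1), kkK_congr (T y0) (Zr y0) (T z0) (Zr z0) (E1 nY0),
    decK_congr (T y1) (Zr y1), kkK_congr (T x0) (Zr x0) (T z0) (Zr z0) (E1 nX0),
    decK_congr (T z1) (Zr z1), kkK_congr (T x0) (Zr x0) (T y0) (Zr y0) (E1 nX0),
    s6K_congr (T x1) (Zr x1) (T y0) (Zr y0) (T z0) (Zr z0) (E1 (nU hx1)) (E1 nY0) (E1 (nU hx1)),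
    s6K_congr (T x0) (Zr x0) (T y1) (Zr y1) (T z0) (Zr z0) (E1 nX0) (E1 (nU hy1)) (E1 nX0),
    s6K_congr (T x0) (Zr x0) (T y0) (Zr y0) (T z1) (Zr z1) (E1 nX0) (E2 (nU hz1)) (E2 (nU hz1))]
  have cp : p ≠ Fin.last (k + 1) → p ≠ 0 → c p = 1 := by
    intro h1 h2; show chart4 k p x0 y0 p = 1; unfold chart4; simp [h1, h2]
  have up : ∀ {u : Fin (k + 2)}, (u = 0 ∨ u = p ∨ u = Fin.last (k + 1)) → (c u = 0 ∨ c u = 1 ∨ c u = 5) := by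
    intro u hu
    rcases hu with h | h | h
    · exact Or.inl ((Zr u).1 h)
    · by_cases h1 : p = Fin.last (k + 1)
      · exact Or.inr (Or.inr (e5 ▸ (T u).1 (h.trans h1)))
      by_cases h2 : p = 0
      · exact Or.inl ((Zr u).1 (h.trans h2))
      · exact Or.inr (Or.inl (h ▸ cp h1 h2))
    · exact Or.inr (Or.inr (e5 ▸ (T u).1 h))
  have lo : ∀ {u v : Fin (k + 2)}, (u ≠ Fin.last (k + 1) → u ≠ 0 → u ≠ p → u ≠ x0 → u ≠ y0 → False) →
      (u = v ∨ u = 0 ∨ v = Fin.last (k + 1)) → (c u = c v ∨ c u = 0 ∨ c v = 5) := by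
    intro u v hu h
    rcases h with h | h | h
    · exact Or.inl ((E1 hu).1 h)
    · exact Or.inr (Or.inl ((Zr u).1 h))
    · exact Or.inr (Or.inr (e5 ▸ (T v).1 h))
  -- `z0` may be an "other" petal: use the primed equality lemma with `z1` never other
  have loz : c z0 = c z1 ∨ c z0 = 0 ∨ c z1 = 5 := by
    rcases hz with h | h | h
    · exact Or.inl ((E2 (nU hz1)).1 h)
    · exact Or.inr (Or.inl ((Zr z0).1 h))
    · exact Or.inr (Or.inr (e5 ▸ (T z1).1 h))
  exact uopIneq6 _ _ _ _ _ _ (uopCode_of _ _ (lo nX0 hx) (up hx1)) (uopCode_of _ _ (lo nY0 hy) (up hy1)) (uopCode_of _ _ loz (up hz1))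

/-! ## (MZₖ) at an upper-one-petal coordinate -/

namespace MSunflower

variable {k : ℕ} (F : MSunflower k α)

/-- Decided-spectator Gladkov sums with a weight in `{0,1}` are nonnegative. [this work] -/
theorem nested_decK_kkK_nonneg (W : Finset α) (e : α) :
    0 ≤ nested W (fun X Y Z => decK k (F.lab (insert e X)) * kkK k (F.lab Y) (F.lab Z)) := by
  unfold nested
  refine sum_nonneg fun X _ => ?_
  rw [← mul_sum]
  refine mul_nonneg (by unfold decK; split_ifs <;> norm_num) ?_
  exact F.antipodal_gladkov (W \ X)

/-- **(MZₖ) AT AN UPPER-ONE-PETAL COORDINATE** (this work): if `e ∉ W` and every upper label `lab (insert e X)`, `X ⊆ W`, lies in `{0, p, ⊤}` for one label `p`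
(e.g. `p = petalLab i₀`: the upper section uses at most one petal colour), then the sub-cube functional does not decrease when `e` is added:
`nested W (s6K ∘ lab) ≤ nested (insert e W) (s6K ∘ lab)`.  Every number `k` of petals. [this work] -/
theorem nested_le_nested_insert_of_upper_le_one_petal (W : Finset α) (e : α) (he : e ∉ W) (p : Fin (k + 2))
    (hup : ∀ X ⊆ W, F.lab (insert e X) = 0 ∨ F.lab (insert e X) = p ∨ F.lab (insert e X) = Fin.last (k + 1)) :
    nested W (fun X Y Z => s6K k (F.lab X) (F.lab Y) (F.lab Z))
      ≤ nested (insert e W) (fun X Y Z => s6K k (F.lab X) (F.lab Y) (F.lab Z)) := by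
  rw [nested_insert_split W e he]
  have h1 := F.nested_decK_kkK_nonneg W e
  have h2 : 0 ≤ nested W (fun X Y Z => decK k (F.lab (insert e Y)) * kkK k (F.lab X) (F.lab Z)) := by
    rw [nested_swap12]; exact F.nested_decK_kkK_nonneg W e
  have h3 : 0 ≤ nested W (fun X Y Z => decK k (F.lab (insert e Z)) * kkK k (F.lab X) (F.lab Y)) := by
    rw [nested_swap23, nested_swap12]
    exact F.nested_decK_kkK_nonneg W e
  have key : nested W (fun X Y Z => s6K k (F.lab X) (F.lab Y) (F.lab Z))
      + nested W (fun X Y Z => decK k (F.lab (insert e X)) * kkK k (F.lab Y) (F.lab Z))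
      + nested W (fun X Y Z => decK k (F.lab (insert e Y)) * kkK k (F.lab X) (F.lab Z))
      + nested W (fun X Y Z => decK k (F.lab (insert e Z)) * kkK k (F.lab X) (F.lab Y))
      ≤ nested W (fun X S T => s6K k (F.lab (insert e X)) (F.lab S) (F.lab T))
        + nested W (fun X S T => s6K k (F.lab X) (F.lab (insert e S)) (F.lab T))
        + nested W (fun X S T => s6K k (F.lab X) (F.lab S) (F.lab (insert e T))) := by
    unfold nested
    rw [← sum_add_distrib, ← sum_add_distrib, ← sum_add_distrib, ← sum_add_distrib, ← sum_add_distrib]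
    refine sum_le_sum fun X hX => ?_
    rw [← sum_add_distrib, ← sum_add_distrib, ← sum_add_distrib, ← sum_add_distrib, ← sum_add_distrib]
    refine sum_le_sum fun Y hY => ?_
    have hXW : X ⊆ W := mem_powerset.1 hX
    have hYW : Y ⊆ W \ X := mem_powerset.1 hY
    have hYW' : Y ⊆ W := fun a ha => (mem_sdiff.1 (hYW ha)).1
    have hTW : (W \ X) \ Y ⊆ W := fun a ha => (mem_sdiff.1 (mem_sdiff.1 ha).1).1
    exact uopIneqK p _ _ _ _ _ _ (F.lab_mono (subset_insert e X)) (F.lab_mono (subset_insert e Y))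
      (F.lab_mono (subset_insert e ((W \ X) \ Y))) (hup X hXW) (hup Y hYW') (hup _ hTW)
  linarith

end MSunflower

end Summit.CriticalPhenomena.PercolationContinuityZ3.Theorems.SunflowerPartition
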